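import Literature.NumberTheory.EllipticCurves.Rank1Residual.CornerFTwoCertificates.Schema
import Literature.NumberTheory.EllipticCurves.Rank1Residual.X11RankOneCertificates.Instances
import Literature.NumberTheory.QuadraticFields.RedeiReichardtCertificates
import Literature.NumberTheory.EllipticCurves.Wang2016.SelmerRankTwoIffFourRankOne
import Literature.NumberTheory.EllipticCurves.HuShuYin2019.SylvesterThreePart
import HarnessLib

/-!
# The CM corner at `p = 2` in analytic rank one — what a certificate record DISCHARGES and CLAIMS, and `BSD(E,2)` from it

HONEST FRAMING (cell `bsd-print-cf2`, run/shared/lean/pub/bsd-print-cf2/, D-0131 (2) PRINT TIER, seat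
ty3; verbatim): PARTITION currency only — the leaf `CornerF @ 2` counts when its class theorem is in the
kernel BY NAME; Literature named facts are statement-only with cite tags; every imported theorem carries
its printed hypotheses verbatim. Companion of `Schema.lean` (the record FORMAT and its in-kernel recheck)
and of the display files `Records*.lean`. This file says, in the tree's vocabulary, what a CERTIFIED
record gives for its curve — theorems only, plus ONE predicate with an argument (`Record.Claim`, the
meaning of the numeric columns; not a named fact):

* §1 list plumbing (a checked prime list is a list of distinct primes; its product is square-free; the
  Rédei prime tuple read off a list) and the arithmetic of the two naive rechecks (`powMod`, `natVal`);
* §2 `congruentLLT` records: the recheck DISCHARGES every printed hypothesis of Li–Liu–Tian 2024 Thm. 1.2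
  — `n` square-free, `n ≡ 5 (mod 8)`, all prime factors `≡ 1 (mod 4)` (decoded from the data), and
  "`ℚ(√−n)` has no ideal class of order `4`" from the KERNEL Rédei count through the tree's PROVED
  Rédei–Reichardt theorem (`RedeiReichardt.noIdealClassOfOrderFour_of_card_ker'`) — hence
  `Record.bsdp_two_of_check_llt : BSDp (congruentNumberCurve n) 2` (indeed every prime) modulo the ONE
  named fact `LiLiuTian2024.thm12_bsd_congruentNumberCurve`; list form `bsdp_two_of_certified_llt` for
  the display files. This is the leaf pair CLOSED BY NAME, member by member, flag-free.
* (§3, the `congruentTian` records — Tian 2014 Thm. 1.3's hypotheses discharged, condition (1.1) via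
  the kernel Rédei count and the concrete `sqrtField (−2n)`, and `BSD(E_m, 2)` from the numeric claim —
  is the sibling file `ClaimTian.lean`, split off for length.)
* §4 `sylvester` / `sylvesterSq` records: the recheck DISCHARGES "`p` prime, `p ≡ 4, 7 (mod 9)`, `3` not
  a cube mod `p`" (the cubic bit `3^{(p−1)/3} ≢ 1` ⇒ no cube root, by Fermat) — the printed hypotheses of
  Hu–Shu–Yin 2019 Thm. 1.3/1.4 and Dasgupta–Voight 2018 Thm. 2, for the discharge interface (ty2) and
  the provers; `BSD(E_p, 2)` itself is OPEN in print and is not concluded here.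
* §5 `Record.Claim`: the numeric columns in the tree's vocabulary (`analyticRank`, `mordellWeilRank`,
  Miller's `shaAn`), to be taken as a hypothesis `(hC : r.Claim)` where a theorem consumes them.

References: [LiLiuTian2024] Thm. 1.2; [Tian2014] Thm. 1.3, (1.1), Rem. 1.4; [LiMa2008] Thm. 0.4;
[HuShuYin2019] Thm. 1.3/1.4; [DasguptaVoight2018] Thm. 2; [Miller2011LMS] Def. 1.1;
[IrelandRosen1990] Ch. 4 §1 (Fermat) / Ch. 5 §1 (Euler's criterion).
-/

open Matrix NumberField WeierstrassCurve
open Literature.NumberTheory.QuadraticFields.RedeiReichardt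
open Literature.NumberTheory.EllipticCurves.Rank1Residual.X11RankOneCertificates
  (powMod natVal natValAux isPrimeBelow504100 prime_of_isPrimeBelow504100)
open Literature.NumberTheory.EllipticCurves.LiLiuTian2024
open Literature.NumberTheory.EllipticCurves.Tian2014
open Literature.NumberTheory.EllipticCurves.Wang2016 (isQuadraticFieldOfSqrt_sqrtField)

namespace Literature.NumberTheory.EllipticCurves.Rank1Residual.CornerFTwoCertificates

/-! ### §1 List plumbing and the arithmetic of the naive rechecks -/

/-- A list passing `all isPrimeBelow504100` consists of primes. [cite: LiLiuTian2024, Thm. 1.2 (hypothesis: prime factors)] -/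
theorem prime_of_all_isPrime {l : List ℕ} (h : l.all isPrimeBelow504100 = true) {q : ℕ} (hq : q ∈ l) :
    q.Prime :=
  prime_of_isPrimeBelow504100 (List.all_eq_true.1 h q hq)

/-- A product of a list of primes is nonzero. [folklore] -/
private theorem prod_ne_zero_of_prime {l : List ℕ} (hp : ∀ q ∈ l, q.Prime) : l.prod ≠ 0 :=
  List.prod_ne_zero fun h => (hp 0 h).ne_zero rfl

/-- **The product of DISTINCT primes is square-free** (fundamental theorem of arithmetic: the list is a
permutation of `primeFactorsList`). [cite: LiLiuTian2024, Thm. 1.2 (hypothesis: n square-free)] -/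
theorem squarefree_prod_of_nodup {l : List ℕ} (hp : ∀ q ∈ l, q.Prime) (hnd : l.Nodup) :
    Squarefree l.prod := by
  rw [Nat.squarefree_iff_nodup_primeFactorsList (prod_ne_zero_of_prime hp)]
  exact (Nat.primeFactorsList_unique rfl hp).nodup_iff.1 hnd

/-- A prime dividing a product of primes is one of them. [cite: LiLiuTian2024, Thm. 1.2 (hypothesis: all prime factors ≡ 1 (mod 4))] -/
theorem mem_of_prime_dvd_prod {l : List ℕ} (hp : ∀ q ∈ l, q.Prime) {q : ℕ} (hq : q.Prime)
    (hd : q ∣ l.prod) : q ∈ l :=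
  (Nat.primeFactorsList_unique rfl hp).symm.subset
    ((Nat.mem_primeFactorsList (prod_ne_zero_of_prime hp)).2 ⟨hq, hd⟩)

/-- A product of odd numbers is odd. [folklore] -/
private theorem odd_prod_of_forall_odd : ∀ {l : List ℕ}, (∀ q ∈ l, Odd q) → Odd l.prod
  | [], _ => by simp
  | a :: t, h => by
      rw [List.prod_cons]
      exact (h a (by simp)).mul (odd_prod_of_forall_odd fun q hq => h q (by simp [hq]))

/-- The tuple `i ↦ l.get i` multiplies to `l.prod`. [cite: LiMa2008, Lemma 0.1 (p. 279: the primes of D)] -/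
theorem prod_get_eq (l : List ℕ) : ∏ i : Fin l.length, l.get i = l.prod := by
  simp [List.get_eq_getElem]

/-- The tuple of a duplicate-free list is injective. [cite: LiMa2008, Lemma 0.1 (p. 279: distinct primes)] -/
theorem injective_get_of_nodup {l : List ℕ} (h : l.Nodup) : Function.Injective fun i => l.get i :=
  List.nodup_iff_injective_get.1 h

/-- `powMod b e m = b ^ e mod m` (the naive modular power of `X11RankOneCertificates/Schema.lean`).
[cite: IrelandRosen1990, Ch. 4 §1 (modular exponentiation; Fermat's little theorem)] -/
theorem powMod_eq (b m : ℕ) : ∀ e : ℕ, powMod b e m = b ^ e % m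
  | 0 => by simp [powMod]
  | e + 1 => by
      have ih := powMod_eq b m e
      simp only [powMod] at ih ⊢
      rw [List.range_succ, List.foldl_append, List.foldl_cons, List.foldl_nil, ih, pow_succ,
        Nat.mul_mod (b ^ e % m) b m, Nat.mod_mod, ← Nat.mul_mod]

/-- One step of the naive valuation: `natValAux (f+1) q n`. [folklore] -/
private theorem natValAux_succ (f q n : ℕ) :
    natValAux (f + 1) q n = if q < 2 ∨ n = 0 ∨ n % q ≠ 0 then 0 else natValAux f q (n / q) + 1 := rfl

/-- If the naive `2`-valuation of a positive `s` is `0` then `s` is odd. [cite: Miller2011LMS, Def. 1.1 (ord_p of #Ш_an)] -/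
theorem not_two_dvd_of_natVal_eq_zero {s : ℕ} (hs : 0 < s) (h : natVal 2 s = 0) : ¬ 2 ∣ s := by
  intro hd
  have h' : natValAux (199 + 1) 2 s = 0 := h
  rw [natValAux_succ, if_neg (by push Not; exact ⟨le_refl 2, hs.ne', Nat.mod_eq_zero_of_dvd hd⟩)] at h'
  exact Nat.succ_ne_zero _ h'

/-- **The cubic bit is sound**: for a prime `p ≡ 1 (mod 3)`, `3^{(p−1)/3} ≢ 1 (mod p)` implies that `3`
is not a cube modulo `p` (if `x³ = 3` then `3^{(p−1)/3} = x^{p−1} = 1` by Fermat). This is the printed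
hypothesis "`3` is not a cube modulo `p`" of Dasgupta–Voight / Hu–Shu–Yin as a kernel certificate.
[cite: DasguptaVoight2018, Thm. 2 (hypothesis)] [cite: IrelandRosen1990, Ch. 4 §1 Thm. 1 (Fermat) and Ch. 7 §1 (cubic residues)] -/
theorem not_cube_three_of_cubicNonResidueBit {p : ℕ} (hp : p.Prime) (h3 : p % 3 = 1)
    (hb : cubicNonResidueBit p = true) : ¬ ∃ x : ZMod p, x ^ 3 = 3 := by
  rintro ⟨x, hx⟩
  haveI : Fact p.Prime := ⟨hp⟩
  simp only [cubicNonResidueBit, decide_eq_true_eq, powMod_eq] at hb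
  have hx0 : x ≠ 0 := by
    rintro rfl
    have h0 : ((3 : ℕ) : ZMod p) = 0 := by
      rw [Nat.cast_ofNat, ← hx, zero_pow three_ne_zero]
    rw [ZMod.natCast_eq_zero_iff] at h0
    have := (Nat.prime_dvd_prime_iff_eq hp Nat.prime_three).1 h0
    omega
  have hdiv : 3 * ((p - 1) / 3) = p - 1 := Nat.mul_div_cancel' (by omega)
  have h1 : (3 : ZMod p) ^ ((p - 1) / 3) = 1 := by
    rw [← hx, ← pow_mul, hdiv, ZMod.pow_card_sub_one_eq_one hx0]
  have hcast : ((3 ^ ((p - 1) / 3) : ℕ) : ZMod p) = ((1 : ℕ) : ZMod p) := by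
    push_cast
    exact h1
  rw [ZMod.natCast_eq_natCast_iff', Nat.mod_eq_of_lt hp.one_lt] at hcast
  exact hb hcast

/-! ### §2 Decoding a certified record; `congruentLLT`: `BSD(E_n, 2)` by name -/

namespace Record

variable (r : Record)

/-- A passing record is a LEAF record: `rankAn = 1`, `rankMW = 1`, `rootNumber = −1`. [cite: Miller2011LMS, Def. 1.1] -/
theorem leaf_of_check (h : r.check = true) : r.rankAn = 1 ∧ r.rankMW = 1 ∧ r.rootNumber = -1 := by
  have h' := r.checkInvariants_of_check h
  simp only [checkInvariants, Bool.and_eq_true, beq_iff_eq] at h'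
  exact ⟨h'.1.1.1.1.1.1.1.1.1.1.1.1, h'.1.1.1.1.1.1.1.1.1.1.1.2, h'.1.1.1.1.1.1.1.1.1.1.2⟩

/-- A passing record carries at least two engines (the two-engine rule) and an odd `shaAn` claim iff
`ord2ShaAn = 0`; here: `ord2ShaAn = 0 → ¬ 2 ∣ shaAn`. [cite: Miller2011LMS, Def. 1.1] -/
theorem not_two_dvd_shaAn_of_check (h : r.check = true) (h0 : r.ord2ShaAn = 0) : ¬ 2 ∣ r.shaAn := by
  have h' := r.checkInvariants_of_check h
  simp only [checkInvariants, Bool.and_eq_true, beq_iff_eq, decide_eq_true_eq] at h'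
  have hpos : 0 < r.shaAn := h'.1.1.1.1.1.1.1.1.1.2
  have hval : r.ord2ShaAn = natVal 2 r.shaAn := h'.1.1.1.1.1.1.1.2
  exact not_two_dvd_of_natVal_eq_zero hpos (by rw [← hval, h0])

/-- The listed primes of a passing record are prime. [cite: LiLiuTian2024, Thm. 1.2 (hypotheses)] -/
theorem primes_prime (h : r.check = true) : ∀ q ∈ r.primes, q.Prime := by
  have h' := r.checkPrimes_of_check h
  simp only [checkPrimes, Bool.and_eq_true] at h'
  exact fun q hq => prime_of_all_isPrime h'.1.1.2 hq

/-- … and distinct. [cite: Tian2014, Thm. 1.3 (hypothesis: distinct primes)] -/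
theorem primes_nodup (h : r.check = true) : r.primes.Nodup := by
  have h' := r.checkPrimes_of_check h
  simp only [checkPrimes, Bool.and_eq_true, decide_eq_true_eq] at h'
  exact h'.1.2

/-- … and `2` is not in the tail. [cite: Tian2014, Thm. 1.3 (hypothesis: odd primes)] -/
theorem two_not_mem_tail (h : r.check = true) : ∀ q ∈ r.primes.tail, q ≠ 2 := by
  have h' := r.checkPrimes_of_check h
  simp only [checkPrimes, Bool.and_eq_true, List.all_eq_true, decide_eq_true_eq] at h'
  exact h'.2

/-- `congruentLLT` shape decoded: `∏ primes = n`, `n ≡ 5 (mod 8)`, every listed prime `≡ 1 (mod 4)`.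
[cite: LiLiuTian2024, Thm. 1.2 (hypotheses)] -/
theorem llt_shape (h : r.check = true) (hf : r.family = .congruentLLT) :
    r.primes.prod = r.param ∧ r.param % 8 = 5 ∧ ∀ q ∈ r.primes, q % 4 = 1 := by
  have h' := r.checkShape_of_check h
  rw [checkShape, hf] at h'
  simp only [Bool.and_eq_true, beq_iff_eq, List.all_eq_true] at h'
  exact ⟨h'.1.1, h'.1.2, h'.2⟩

/-- `congruentLLT`: `n` is square-free. [cite: LiLiuTian2024, Thm. 1.2 (hypothesis)] -/
theorem squarefree_of_check_llt (h : r.check = true) (hf : r.family = .congruentLLT) :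
    Squarefree r.param := by
  rw [← (r.llt_shape h hf).1]
  exact squarefree_prod_of_nodup (r.primes_prime h) (r.primes_nodup h)

/-- `congruentLLT`: every prime factor of `n` is `≡ 1 (mod 4)`. [cite: LiLiuTian2024, Thm. 1.2 (hypothesis)] -/
theorem prime_factor_mod_four_of_check_llt (h : r.check = true) (hf : r.family = .congruentLLT) :
    ∀ q : ℕ, q.Prime → q ∣ r.param → q % 4 = 1 := by
  obtain ⟨hprod, -, h1⟩ := r.llt_shape h hf
  intro q hq hd
  rw [← hprod] at hd
  exact h1 q (mem_of_prime_dvd_prod (r.primes_prime h) hq hd)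

/-- `congruentLLT`: the Rédei kernel of `ℚ(√−n)` on `(2, primes)` has `2` elements (the record's
`r4 = 0`, RECHECKED). [cite: LiMa2008, Thm. 0.4 (p. 280)] -/
theorem redeiKerCard_eq_two_of_check_llt (h : r.check = true) (hf : r.family = .congruentLLT) :
    redeiKerCard r.param (2 :: r.primes) = 2 := by
  have h' := r.checkRedei_of_check h
  simp only [checkRedei, hf, Family.isCongruent, Bool.and_eq_true, beq_iff_eq, if_true] at h'
  obtain ⟨⟨h1, -⟩, h0⟩ := h'
  rw [h0, redeiTuple, if_pos (by have := (r.llt_shape h hf).2.1; omega)] at h1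
  simpa using h1

/-- **`congruentLLT`: "`ℚ(√−n)` has no ideal class of order `4`" — a KERNEL fact** (the Rédei count of
the record through the tree's proved Rédei–Reichardt theorem). [cite: LiLiuTian2024, Thm. 1.2 (hypothesis)] [cite: LiMa2008, Thm. 0.4 (p. 280)] -/
theorem noIdealClassOfOrderFour_of_check_llt (h : r.check = true) (hf : r.family = .congruentLLT) :
    NoIdealClassOfOrderFour (-(r.param : ℤ)) := by
  obtain ⟨hprod, h8, h1⟩ := r.llt_shape h hf
  have hpr := r.primes_prime h
  have h2 : (2 : ℕ) ∉ r.primes := fun hm => by have := h1 2 hm; omega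
  have hnd : (2 :: r.primes).Nodup := List.nodup_cons.2 ⟨h2, r.primes_nodup h⟩
  have hker := r.redeiKerCard_eq_two_of_check_llt h hf
  unfold redeiKerCard at hker
  refine noIdealClassOfOrderFour_of_card_ker' (p := fun i => (2 :: r.primes).get i) ?_
    (injective_get_of_nodup hnd) ?_ hker
  · intro i
    rcases List.mem_cons.1 (List.get_mem (2 :: r.primes) i) with h2' | hm
    · rw [h2']; exact Nat.prime_two
    · exact hpr _ hm
  · rw [if_pos (by omega), prod_get_eq, List.prod_cons, hprod]

/-- **`BSD(E_n, ℓ)` for EVERY prime `ℓ` on a certified `congruentLLT` record**, modulo the single named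
fact Li–Liu–Tian 2024 Thm. 1.2 (`h12`): the recheck discharged square-freeness, `n ≡ 5 (mod 8)`, the
prime factors `≡ 1 (mod 4)` and — through the kernel Rédei count and the PROVED Rédei–Reichardt theorem
— "no ideal class of order `4`". [cite: LiLiuTian2024, Thm. 1.2] [cite: Miller2011LMS, §1 and Def. 1.1] -/
theorem forall_bsdp_of_check_llt (h12 : thm12_bsd_congruentNumberCurve) (h : r.check = true)
    (hf : r.family = .congruentLLT) (ℓ : ℕ) (hℓ : ℓ.Prime) : BSDp (congruentNumberCurve r.param) ℓ := by
  have hsq := r.squarefree_of_check_llt h hf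
  haveI := isElliptic_congruentNumberCurve (Squarefree.ne_zero hsq)
  haveI := isGloballyMinimal_congruentNumberCurve hsq
  exact forall_bsdp_congruentNumberCurve_of_thm12 h12 hsq (r.llt_shape h hf).2.1
    (r.prime_factor_mod_four_of_check_llt h hf) (r.noIdealClassOfOrderFour_of_check_llt h hf) ℓ hℓ

/-- **THE LEAF PAIR `(E_n, 2)` CLOSED BY NAME on a certified `congruentLLT` record**: `BSD(E_n, 2)`
(Miller) modulo Li–Liu–Tian 2024 Thm. 1.2 only. [cite: LiLiuTian2024, Thm. 1.2] [cite: Miller2011LMS, Def. 1.1] -/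
theorem bsdp_two_of_check_llt (h12 : thm12_bsd_congruentNumberCurve) (h : r.check = true)
    (hf : r.family = .congruentLLT) : BSDp (congruentNumberCurve r.param) 2 :=
  r.forall_bsdp_of_check_llt h12 h hf 2 Nat.prime_two

/-- The printed conclusion in full on a certified `congruentLLT` record: Mordell–Weil rank `1 =`
analytic rank. [cite: LiLiuTian2024, Thm. 1.2] [cite: Tian2023CongruentICM, Thm. 2 (p. 1993)] -/
theorem rank_of_check_llt (h12 : thm12_bsd_congruentNumberCurve) (h : r.check = true)
    (hf : r.family = .congruentLLT) :
    (congruentNumberCurve r.param).mordellWeilRank = 1 ∧ (congruentNumberCurve r.param).analyticRank = 1 := by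
  have hb := bsd_congruentNumberCurve_of_thm12 h12 (r.squarefree_of_check_llt h hf)
    (r.llt_shape h hf).2.1 (r.prime_factor_mod_four_of_check_llt h hf)
    (r.noIdealClassOfOrderFour_of_check_llt h hf)
  exact ⟨hb.1, hb.2.1⟩

end Record

/-- **List form for the display files**: on a `Certified` list of `congruentLLT` records, `BSD(E_n, 2)`
for every member, modulo Li–Liu–Tian 2024 Thm. 1.2. [cite: LiLiuTian2024, Thm. 1.2] [cite: Miller2011LMS, Def. 1.1] -/
theorem bsdp_two_of_certified_llt (h12 : thm12_bsd_congruentNumberCurve) {rs : List Record}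
    (hc : Certified rs) (hf : rs.all (fun r => r.family == .congruentLLT) = true) :
    ∀ r ∈ rs, BSDp (congruentNumberCurve r.param) 2 := fun r hr =>
  r.bsdp_two_of_check_llt h12 (hc.check_of_mem hr)
    (by have := List.all_eq_true.1 hf r hr; simpa using this)


/-! ### §4 `sylvester` / `sylvesterSq`: the printed hypotheses discharged -/

namespace Record

variable (r : Record)

/-- **`sylvester` decoded**: `primes = [p]` with `param = p` PRIME, `p ≡ 4, 7 (mod 9)`, and `3` NOT a
cube modulo `p` (the cubic bit, sound by Fermat) — the printed hypotheses of Hu–Shu–Yin 2019 Thm.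
1.3/1.4 and Dasgupta–Voight 2018 Thm. 2 for `E_p : x³ + y³ = p`. [cite: HuShuYin2019, Thm. 1.3 and Thm. 1.4 (hypotheses)] [cite: DasguptaVoight2018, Thm. 2 (hypotheses)] -/
theorem sylvester_of_check (h : r.check = true) (hf : r.family = .sylvester) :
    r.primes = [r.param] ∧ r.param.Prime ∧ (r.param % 9 = 4 ∨ r.param % 9 = 7) ∧
      ¬ ∃ x : ZMod r.param, x ^ 3 = 3 := by
  have hs := r.checkShape_of_check h
  have hc := r.checkCubic_of_check h
  have hpr := r.primes_prime h
  rw [checkShape, hf] at hs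
  rw [checkCubic, hf] at hc
  match hl : r.primes with
  | [] => rw [hl] at hs; simp at hs
  | _ :: _ :: _ => rw [hl] at hs; simp at hs
  | [p] =>
    rw [hl] at hs hc hpr
    simp only [Bool.and_eq_true, beq_iff_eq, Bool.or_eq_true] at hs hc
    obtain ⟨hpp, h9⟩ := hs
    obtain ⟨⟨-, h3⟩, hb⟩ := hc
    have hpprime : p.Prime := hpr p (by simp)
    rw [hpp]
    exact ⟨rfl, hpprime, h9, not_cube_three_of_cubicNonResidueBit hpprime h3 hb⟩

/-- **`sylvesterSq` decoded**: `primes = [p]`, `param = p²`, `p` prime, `p ≡ 4, 7 (mod 9)`, `3` not a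
cube mod `p` (Dasgupta–Voight 2018 Thm. 2 for `E_{p²}`). [cite: DasguptaVoight2018, Thm. 2 (hypotheses)] -/
theorem sylvesterSq_of_check (h : r.check = true) (hf : r.family = .sylvesterSq) :
    ∃ p : ℕ, r.primes = [p] ∧ r.param = p * p ∧ p.Prime ∧ (p % 9 = 4 ∨ p % 9 = 7) ∧
      ¬ ∃ x : ZMod p, x ^ 3 = 3 := by
  have hs := r.checkShape_of_check h
  have hc := r.checkCubic_of_check h
  have hpr := r.primes_prime h
  rw [checkShape, hf] at hs
  rw [checkCubic, hf] at hc
  match hl : r.primes with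
  | [] => rw [hl] at hs; simp at hs
  | _ :: _ :: _ => rw [hl] at hs; simp at hs
  | [p] =>
    rw [hl] at hs hc hpr
    simp only [Bool.and_eq_true, beq_iff_eq, Bool.or_eq_true] at hs hc
    obtain ⟨hpp, h9⟩ := hs
    obtain ⟨⟨-, h3⟩, hb⟩ := hc
    have hpprime : p.Prime := hpr p (by simp)
    exact ⟨p, rfl, hpp, hpprime, h9, not_cube_three_of_cubicNonResidueBit hpprime h3 hb⟩

end Record

/-! ### §5 What the numeric columns CLAIM (tree vocabulary), and `BSD(E_m, 2)` from the claim -/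

/-- **What a record CLAIMS about its curve** (the two-engine numeric columns in the tree's vocabulary;
to be taken as a hypothesis `(hC : r.Claim)` — engine output, NOT kernel-checked): for the congruent
families, `E_param = congruentNumberCurve param` has analytic rank `rankAn`, Mordell–Weil rank `rankMW`
and Miller's analytic order of `Ш` equal to `shaAn`; for the cube-sum families the same for every
globally minimal `B ≅_ℚ (x³ + y³ = param)` (`HuShuYin2019.cubeSumCurve`). A predicate with an
argument, not a named fact. [cite: Miller2011LMS, §1 and Def. 1.1 (the quantities #Ш_an, r_an)] -/
def Record.Claim (r : Record) : Prop :=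
  if r.family.isCongruent then
    (congruentNumberCurve r.param).analyticRank = r.rankAn ∧
      (congruentNumberCurve r.param).mordellWeilRank = r.rankMW ∧
      Literature.NumberTheory.EllipticCurves.shaAn (congruentNumberCurve r.param) = (r.shaAn : ℂ)
  else
    ∀ (B : WeierstrassCurve ℚ) [B.IsElliptic] [B.IsGloballyMinimal],
      (∃ C : VariableChange ℚ, C • B = HuShuYin2019.cubeSumCurve (r.param : ℚ)) →
      B.analyticRank = r.rankAn ∧ B.mordellWeilRank = r.rankMW ∧
        Literature.NumberTheory.EllipticCurves.shaAn B = (r.shaAn : ℂ)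

end Literature.NumberTheory.EllipticCurves.Rank1Residual.CornerFTwoCertificates
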